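import Literature.AnabelianGeometry.SemiGraphs.BTempQDPairCategoryP
import Literature.AnabelianGeometry.SemiGraphs.BTempQDPairGaloisDomination
import Literature.AnabelianGeometry.SemiGraphs.QuasiTemperoidsQDPairFunctor
import Literature.AlgebraicGeometry.Frobenioids.QuasiTemperoidGaloisBase
import HarnessLib

/-!
# Semi-graphs of anabelioids, Appendix, proof of Theorem A.4: the category `P_i` (strongly connected
# core) IN THE SCOPE OF `D_i` — QD-pairs of `Q_i = T_i[A_i]` — and the equivalence `P_i ⥲ T_i⁰`

Mochizuki, *Semi-graphs of anabelioids*, Publ. RIMS **42** (2006) 221–322, Appendix, proof of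
Theorem A.4, manuscript pp. 83, 85 (PRIMS p. 313 ll. 2–5, p. 315 ll. 1–12)
[cite: MochizukiSemiAnbd2006, Thm A.4 proof p.85]: "`D_i` for the category whose objects are QD-pairs
of `Q_i` [`= T_i[A_i]`] … every connected object of `T_i` is isomorphic to the image via `q_i` of a
strongly connected QD-pair … `P_i` for the category whose objects are the objects of `D_i` and whose
morphisms are given by the "`Hom^`'s" … `Q_i → D_i → P_i ⥲ T_i` … the third functor is the
equivalence induced by the natural functor `D_i → T_i`".

Scope companion of `BTempQDPairCategoryP.lean` (row A4-lim-P-core of `plan/L3/SUBDAG-SemiAnbd-Cor311.md`,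
seat abc-iut-w4-d081): there the objects of `PCore κ` are the strongly connected QD-pairs of the WHOLE
temperoid `T = B^temp(Π)`; print's `D_i` consists of QD-pairs of the quasi-temperoid `Q_i = T_i[A_i]`,
i.e. (for the model, `A = Π/K`, `K` open) pairs `(B, Γ_B)` with `B` ADMITTING AN ARROW TO `Π/K`
(`T[A] = B^temp(Π)[Π/K] = BTempRel Π K`; `Γ_B ≤ Aut_{T[A]}(B) = Aut_T(B)` since `T[A] ⊆ T` is full).
This file cuts that scope out of `PCore κ` as a full subcategory and proves the printed equivalence
there, using abc-iut-w5-d129's scope-correct essential surjectivity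
(`QDPair.exists_stronglyConnected_rel_orbitQuotient_iso`, `BTempQDPairGaloisDomination.lean`):

* `PCore.inScope κ K` / `PCore.Rel κ K` — the full subcategory of `PCore κ` on the pairs of `D_i`;
* `PCore.toT₀Rel : Rel κ K ⥤ (B^temp(Π))⁰` — faithful, full (`Π` tempered) and essentially surjective
  (`Π` tempered, `K` open), hence **`PCore.equivConnectedPartRel : Rel κ K ≌ ConnectedPart (BTemp Π)`**
  = "`P_i ⥲ T_i`" on the strongly connected core of `D_i` onto the connected objects of `T_i`;
* `PCore.ofDRel` — "the second functor `D_i → P_i`" on the strongly connected core of `D_i`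
  (`D_i`'s strongly connected objects, a full subcategory of `QDPair (BTempRel Π K)`, through
  abc-iut-w4-d110's `QDPair.mapFunctor` along the inclusion `T[A] ⥤ T` and `PCore.ofD`).

Elementary; nothing refers to the IUT corpus; no side is taken on any disputed claim.
-/

open CategoryTheory

namespace Literature.AnabelianGeometry.SemiGraphs

open Literature.AlgebraicGeometry.Frobenioids (IsConnectedObj connectedObjects ConnectedPart)
open Literature.AlgebraicGeometry.Frobenioids.QuasiTemperoid (admitsHomToCoset BTempRel
  isConnectedObj_obj_of_rel)

universe u

namespace QDPair

namespace PCore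

variable {G : Type u} [Group G] [TopologicalSpace G] [IsTopologicalGroup G]
  (κ : HomHatCompLaw G) (K : Subgroup G)

/-- The objects of `D_i` among those of `P`: strongly connected QD-pairs `(B, Γ_B)` with `B` admitting
an arrow to `A = Π/K`, i.e. QD-pairs of `Q_i = T[A] = B^temp(Π)[Π/K]`.
[cite: MochizukiSemiAnbd2006, Thm A.4 proof p.83] -/
def inScope : ObjectProperty (PCore κ) := fun P => admitsHomToCoset G K P.pair.A

/-- **`P_i` (strongly connected core) in the scope of `D_i`**: the full subcategory of `PCore κ` on
the QD-pairs of `T[A]`, `A = Π/K`. [cite: MochizukiSemiAnbd2006, Thm A.4 proof p.85] -/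
abbrev Rel : Type (u + 1) := (inScope κ K).FullSubcategory

/-- The functor `P_i → T_i⁰` in `D_i`-scope: `(B, Γ_B) ↦ B/Γ_B`, `x ↦ q(x)`.
[cite: MochizukiSemiAnbd2006, Thm A.4 proof p.85] -/
noncomputable def toT₀Rel : Rel κ K ⥤ ConnectedPart (BTemp G) := (inScope κ K).ι ⋙ toT₀ κ

/-- `P_i → T_i⁰` (scoped) followed by `T_i⁰ ⊆ T_i` is `P → T` restricted.
[cite: MochizukiSemiAnbd2006, Thm A.4 proof p.85] -/
theorem toT₀Rel_obj (P : Rel κ K) : ((toT₀Rel κ K).obj P).obj = P.obj.pair.orbitQuotient := rfl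

/-- `P_i → T_i⁰` (scoped) is faithful. [cite: MochizukiSemiAnbd2006, Thm A.4 proof p.85] -/
instance faithful_toT₀Rel : (toT₀Rel κ K).Faithful := by
  unfold toT₀Rel; infer_instance

/-- `P_i → T_i⁰` (scoped) is full, `Π` tempered. [cite: MochizukiSemiAnbd2006, Thm A.4 proof p.85] -/
theorem full_toT₀Rel (hG : IsTempered G) : (toT₀Rel κ K).Full := by
  haveI := full_toT₀ κ hG
  unfold toT₀Rel; infer_instance

/-- **`P_i → T_i⁰` (scoped) is essentially surjective** — "every connected object of `T_i` is
isomorphic to the image via `q_i` of a strongly connected QD-pair" OF `D_i` (`Π` tempered, `K` open: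
`B = Π/N` for an open normal `N ≤ Stab(x₀) ∩ K`, abc-iut-w5-d129's
`exists_stronglyConnected_rel_orbitQuotient_iso`). [cite: MochizukiSemiAnbd2006, Thm A.4 proof p.83] -/
theorem essSurj_toT₀Rel (hG : IsTempered G) (hK : IsOpen (K : Set G)) : (toT₀Rel κ K).EssSurj :=
  ⟨fun X => by
    obtain ⟨P, hPA, hP, ⟨e⟩⟩ := exists_stronglyConnected_rel_orbitQuotient_iso hG hK X.obj X.property
    exact ⟨⟨⟨P, hP⟩, hPA⟩, ⟨(connectedObjects (BTemp G)).isoMk e⟩⟩⟩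

/-- `P_i → T_i⁰` (scoped) is an equivalence of categories, `Π` tempered, `K` open.
[cite: MochizukiSemiAnbd2006, Thm A.4 proof p.85] -/
theorem isEquivalence_toT₀Rel (hG : IsTempered G) (hK : IsOpen (K : Set G)) :
    (toT₀Rel κ K).IsEquivalence :=
  { faithful := faithful_toT₀Rel κ K, full := full_toT₀Rel κ K hG, essSurj := essSurj_toT₀Rel κ K hG hK }

/-- **"`P_i ⥲ T_i`, the equivalence induced by the natural functor `D_i → T_i`"** — on the strongly
connected core of `D_i = {QD-pairs of T_i[A_i]}` onto the connected objects of `T_i`, for the model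
`T = B^temp(Π)`, `A = Π/K` (`Π` tempered, `K` open). [cite: MochizukiSemiAnbd2006, Thm A.4 proof p.85] -/
noncomputable def equivConnectedPartRel (hG : IsTempered G) (hK : IsOpen (K : Set G)) :
    Rel κ K ≌ ConnectedPart (BTemp G) :=
  haveI := isEquivalence_toT₀Rel κ K hG hK
  (toT₀Rel κ K).asEquivalence

/-- The equivalence is the scoped `P_i → T_i⁰`. [cite: MochizukiSemiAnbd2006, Thm A.4 proof p.85] -/
theorem equivConnectedPartRel_functor (hG : IsTempered G) (hK : IsOpen (K : Set G)) :
    (equivConnectedPartRel κ K hG hK).functor = toT₀Rel κ K := rfl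

/-! ### The functor `D_i → P_i` on the strongly connected core of `D_i` -/

/-- The strongly connected QD-pairs of `D_i` (QD-pairs of `T[A] = BTempRel Π K` with connected
underlying object) map into the strongly connected QD-pairs of `T`: the underlying QD-pair of `T`
(`QDPair.mapFunctor` along the full inclusion `T[A] ⥤ T`, abc-iut-w4-d110; = abc-iut-w5-d129's
`QDPair.toBTemp` on objects) of a connected object of `T[A]` is connected in `T`
(`isConnectedObj_obj_of_rel`). [cite: MochizukiSemiAnbd2006, Thm A.4 proof p.85] -/
noncomputable def toStronglyConnected :
    (stronglyConnected (BTempRel G K)).FullSubcategory ⥤ (stronglyConnected (BTemp G)).FullSubcategory :=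
  (stronglyConnected (BTemp G)).lift
    ((stronglyConnected (BTempRel G K)).ι ⋙ mapFunctor (admitsHomToCoset G K).ι)
    fun P => isConnectedObj_obj_of_rel G K P.obj.A P.property

/-- **"the second functor `D_i → P_i` arises from the construction of `P_i`"** — on the strongly
connected core of `D_i`, valued in `P_i` in `D_i`-scope: `(B, Γ_B) ↦ (B, Γ_B)`, `f ↦ [(id, f̄)]`.
[cite: MochizukiSemiAnbd2006, Thm A.4 proof p.85] -/
noncomputable def ofDRel : (stronglyConnected (BTempRel G K)).FullSubcategory ⥤ Rel κ K :=
  (inScope κ K).lift (toStronglyConnected K ⋙ ofD κ) fun P => P.obj.A.property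

/-- `D_i → P_i → T_i⁰` (scoped) on objects is `q`: `(B, Γ_B) ↦ B/Γ_B` of the underlying QD-pair of `T`.
[cite: MochizukiSemiAnbd2006, Thm A.4 proof p.85] -/
theorem toT₀Rel_obj_ofDRel_obj (P : (stronglyConnected (BTempRel G K)).FullSubcategory) :
    ((toT₀Rel κ K).obj ((ofDRel κ K).obj P)).obj =
      ((mapFunctor (admitsHomToCoset G K).ι).obj P.obj).orbitQuotient := rfl

/-- `D_i → P_i → T_i⁰` (scoped) on arrows is `q` on the underlying arrow of `T`.
[cite: MochizukiSemiAnbd2006, Thm A.4 proof p.85] -/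
theorem toT₀Rel_map_ofDRel_map {P C : (stronglyConnected (BTempRel G K)).FullSubcategory} (f : P ⟶ C) :
    ((toT₀Rel κ K).map ((ofDRel κ K).map f)).hom =
      orbitQuotientMap ((mapFunctor (admitsHomToCoset G K).ι).map f.hom) :=
  toT_map_ofD_map κ ((toStronglyConnected K).map f)

end PCore

end QDPair

end Literature.AnabelianGeometry.SemiGraphs
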